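import Summits.ABC.ABC.Theorems.IsogenyGlueCongruenceMazurKenkuBoundOfEightTables
import Summits.ABC.ABC.Theorems.IsogenyGlueCongruenceMazurKenkuBoundStubKleinSevenRat
import HarnessLib

/-!
# Crux `MazurKenkuBound` (stmt-ABC-15125), line `radius-lite` — Kenku's level `21` UNCONDITIONALLY
# (`computational`), and the crux from THREE printed inputs: Cor. 4.4, eight `j`-tables, six levels

Route `IsogenyGlueCongruence`, lead c22, cycle 24 (2026-08-17). The conditional level-`21` theorem
`levelTwentyOne_jTable_of` of `…OfEightTables.lean` (p166061; explicit isomorphism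
`X₀(3) ×_{X(1)} X₀(7) ≅ 21a1`, the Mordell–Weil group of `21a1`) fed with the landed
`stub_kleinSevenRat` (p165837: Klein–Fricke at `7` over `ℚ` with no exception at `j = 0`; proved in
the tree but `computational` — `native_decide` certificates `gamma7_cert`, `gamma7b_cert`), giving:

* `levelTwentyOne_jTable` (registered stub of the line): **a cyclic `ℚ`-isogeny of degree `21` out
  of `V` forces `j(V) ∈ {−3²5⁶/2³, 3³5³/2, −3²5³101³/2²¹, −3³5³383³/2⁷}`** — Kenku's table at
  `N = 21`, i.e. the non-cuspidal rational points of `X₀(21)` (Ligozat 1975), modular-curve-free;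
* `mazurKenkuRadius_of_three`, `mazurKenkuBound_of_three`: the sibling crux
  `RibetTakahashiSplit.MazurKenkuRadius` and the crux hold conditionally on EXACTLY the three
  printed inputs left after cycle 24 — Mazur's Cor. 4.4 (`h44`), the eight `j`-tables
  `N ∈ {11, 17, 19, 27, 37, 43, 67, 163}` (`hT8`), the six smooth levels `26, 35, 49, 65, 125, 169`
  (`hL6`).

The whole file is `computational` (it inherits `Lean.ofReduceBool` from Klein–Fricke at `7`); its
axiom-clean counterpart with `hK7` displayed is `…OfEightTables.lean`.

## References
[Kenku1982] M. A. Kenku, J. Number Theory 15 (1982) 199–202, proof of Thm. 1 · [Ligozat1975]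
G. Ligozat, Mém. SMF 43 · [Mazur1978] B. Mazur, Invent. Math. 44 (1978), Thm. 1, Cor. 4.4 ·
[PastenShimura2024] §3 p. 13.
-/

-- `Summit.ABC.ABC` is the mandated summit-side namespace (CONVENTIONS §2); the duplicate is deliberate.
set_option linter.dupNamespace false

noncomputable section
open scoped Classical
open WeierstrassCurve
open Literature.NumberTheory.EllipticCurves

namespace Summit.ABC.ABC.Theorems

/-- **Kenku's table at level `21`, unconditionally** (`computational`): a cyclic `ℚ`-isogeny of
degree `21` out of an elliptic curve `V/ℚ` has `(21, j(V)) ∈ kenkuIsogenyJTable`, i.e.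
`j(V) ∈ {−140625/8, 3375/2, −1159088625/2097152, −189613868625/128}` — the four non-cuspidal
rational points of `X₀(21) ≅ 21a1` (`levelTwentyOne_jTable_of` + `stub_kleinSevenRat`).
[cite: Kenku1982, proof of Thm. 1, p. 200] [cite: Ligozat1975] -/
theorem levelTwentyOne_jTable (V V' : WeierstrassCurve ℚ) [V.IsElliptic] [V'.IsElliptic]
    (ψ : Isogeny V V') (hψ : ψ.IsCyclic) (hdeg : ψ.degree = 21) :
    (21, V.j) ∈ kenkuIsogenyJTable :=
  levelTwentyOne_jTable_of stub_kleinSevenRat V V' ψ hψ hdeg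

/-- **The Mazur–Kenku radius** (sibling crux stmt-ABC-15193) **from the THREE printed inputs left
after cycle 24**: Mazur's Cor. 4.4, the eight `j`-tables, the six smooth levels
(`mazurKenkuRadius_of_eight` + `stub_kleinSevenRat`; `computational`).
[cite: Mazur1978, Thm. 1 and Cor. 4.4] [cite: Kenku1982, Thm. 1] -/
theorem mazurKenkuRadius_of_three (h44 : Mazur1978.cor44_valuation_j_le_one)
    (hT8 : ∀ (V V' : WeierstrassCurve ℚ) [V.IsElliptic] [V'.IsElliptic] (ψ : Isogeny V V'),
      ψ.IsCyclic → ψ.degree ∈ ({11, 17, 19, 27, 37, 43, 67, 163} : Finset ℕ) →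
        (ψ.degree, V.j) ∈ kenkuIsogenyJTable)
    (hL6 : ∀ (V V' : WeierstrassCurve ℚ) [V.IsElliptic] [V'.IsElliptic] (ψ : Isogeny V V'),
      ψ.IsCyclic → ψ.degree ∉ ({26, 35, 49, 65, 125, 169} : Finset ℕ)) :
    Summit.ABC.ABC.Theses.RibetTakahashiSplit.MazurKenkuRadius :=
  mazurKenkuRadius_of_eight h44 hT8 hL6 stub_kleinSevenRat

/-- **The crux `MazurKenkuBound` (stmt-ABC-15125) from the THREE printed inputs left after cycle
24**: Mazur's Cor. 4.4 (`h44`), the eight `j`-tables `N ∈ {11, 17, 19, 27, 37, 43, 67, 163}`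
(`hT8`), the six smooth levels `26, 35, 49, 65, 125, 169` (`hL6`) (`mazurKenkuBound_of_eight` +
`stub_kleinSevenRat`; `computational`). [cite: PastenShimura2024, §3 p. 13]
[cite: Mazur1978, Thm. 1 and Cor. 4.4] [cite: Kenku1982, Thm. 1] -/
theorem mazurKenkuBound_of_three (h44 : Mazur1978.cor44_valuation_j_le_one)
    (hT8 : ∀ (V V' : WeierstrassCurve ℚ) [V.IsElliptic] [V'.IsElliptic] (ψ : Isogeny V V'),
      ψ.IsCyclic → ψ.degree ∈ ({11, 17, 19, 27, 37, 43, 67, 163} : Finset ℕ) →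
        (ψ.degree, V.j) ∈ kenkuIsogenyJTable)
    (hL6 : ∀ (V V' : WeierstrassCurve ℚ) [V.IsElliptic] [V'.IsElliptic] (ψ : Isogeny V V'),
      ψ.IsCyclic → ψ.degree ∉ ({26, 35, 49, 65, 125, 169} : Finset ℕ)) :
    Summit.ABC.ABC.Theses.IsogenyGlueCongruence.MazurKenkuBound :=
  mazurKenkuBound_of_eight h44 hT8 hL6 stub_kleinSevenRat

end Summit.ABC.ABC.Theorems

end
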